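import Summits.HodgeConjecture.HodgeConjecture.Theorems.Ring2WeilCoverageCMFieldRationalClassesPrimeSupport
import Summits.HodgeConjecture.HodgeConjecture.Theorems.Ring2WeilCoverageCMFieldRationalClassesDyadicInstances
import Summits.HodgeConjecture.HodgeConjecture.Theorems.Ring2WeilCoverageCMFieldRationalClassesFibresInstancesIII
import Summits.HodgeConjecture.HodgeConjecture.Theorems.Ring2WeilCoverageCMFieldRationalClassesInertRadicand
import HarnessLib

/-!
# Ring 2 — Weil-family coverage, CM-field rows: the UNION STATEMENT for the rational classes — instances III
  (`ℚ(i,√15)`, `ℚ(√-5,√3)`, `ℚ(√-3,√-5)`) (WEIL-FAMILY-COVERAGE «## b03», cell (xxi⁷), part 44)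

research route conditional on HC_CM; not a corollary; Q11.4-sentence-2 already refuted in dim ≥ 3.

For each biquadratic census carrier `R = S² + pS + q` below (`E = F(√b₀)`, `b₀ ∈ {-1,-2,-3,-5}`, `F` real quadratic with
one dyadic place; rows `δ ∈ F^×/Nm_{E/F}(E^×)` labelled by `T(q) = {𝔭 : (q, θ)_𝔭 = -1}`)
[cite: Deligne1982HodgeCycles, §4 p. 30, (1), Cor. 4.2] part 41's union statement is discharged of its hypotheses
(the dyadic place: part 40; the odd radicand / ramified places: parts 34–38) and read through the prime rule of parts
16–20 (`[ℓ] ≠ [1] ⟺ ℓ mod N ∈ S_E`):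

* `KEY_inl_notMem_badPlaces_natCast_of_exceptional` — the dyadic place and the places dividing `b₀` lie in no `T(ℓ)`;
* **`KEY_inl_mem_badPlaces_ratCast_iff_odd_padicValRat`** — for `c ∈ ℚ_{>0}` and a finite place `v` over the prime `ℓ`:
  **`v ∈ T(c) ⟺ ord_ℓ(c)` odd `∧ ℓ mod N ∈ S_E`** — `T(c)` is the union of the full fibres of `Spec 𝓞_F → Spec ℤ` over
  the primes `ℓ ≡ S_E (mod N)` of odd exponent in `c`;
* **`KEY_mk_ratCast_eq_mk_ratCast_iff`** — `[c] = [c'] ⟺ ord_ℓ(c) ≡ ord_ℓ(c') (mod 2)` for every prime `ℓ ≡ S_E (mod N)`;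
* **`KEY_mk_ratCast_eq_splitDiscriminantClassCM_iff`** — `[c] = [(-1)^k]` (`k` even) `⟺ ord_ℓ(c)` even for every
  prime `ℓ ≡ S_E (mod N)`.

So the positive rational members of each table `W_{2k}.E.T` are classified by the finite sets of primes in the classes
`S_E mod N`, and the rational rows are EXACTLY the finite unions of fibres over such primes [cite: Omeara1963, §63B
Cor. 63:11a, Example 63:12, §65D Thm. 65:23 and §71D Thm. 71:18].  No new definition, no named fact, no sorry; nothing
about the Hodge conjecture is asserted.
-/

noncomputable section

set_option linter.dupNamespace false

open Polynomial NumberField IsDedekindDomain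

namespace Summit.HodgeConjecture.HodgeConjecture.Ring2.WeilCoverageCM

open Literature.AlgebraicGeometry.Deligne1982
open Literature.AlgebraicGeometry.HodgeTheory (splitDiscriminantClassCM)
open Literature.NumberTheory.QuadraticForms

variable {R : Polynomial ℤ} [Fact (Irreducible (cmPolyQ R))] [Fact (Irreducible (realPolyQ R))]

/-! ### §125 `E = ℚ(i,√15)` (`R = S² + 32S + 196`, `F = ℚ(√15)`, `E = F(√-1)`; non-norm primes: `ℓ % 60 = 7 ∨ ℓ % 60 = 11 ∨ ℓ % 60 = 43 ∨ ℓ % 60 = 59`) -/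
section IsqrtNeg1Sqrt15

/-- `ℚ(i,√15)`: **the dyadic place of `F = ℚ(√15)` and the places dividing the radicand `b₀ = -1` lie in no `T(ℓ)`**,
`ℓ` a rational prime (parts 34–40). [cite: Omeara1963, §63B Example 63:12 and §71D Thm. 71:18]
[cite: Deligne1982HodgeCycles, §4 (1)] -/
theorem sqrtNeg1Sqrt15_inl_notMem_badPlaces_natCast_of_exceptional (hR : R = X ^ 2 + C 32 * X + C 196)
    (v : HeightOneSpectrum (𝓞 (realField R)))
    (hv : (2 : 𝓞 (realField R)) ∈ v.asIdeal ∨ (((-(1 : ℕ) : ℤ)) : 𝓞 (realField R)) ∈ v.asIdeal)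
    (ℓ : ℕ) (hℓ : ℓ.Prime) :
    Sum.inl v ∉ badPlaces (ℓ : realField R) (AdjoinRoot.root (realPolyQ R)) := by
  have h2 : (2 : 𝓞 (realField R)) ∈ v.asIdeal → Sum.inl v ∉ badPlaces (ℓ : realField R) (AdjoinRoot.root (realPolyQ R)) := by
    intro h2v
    have h := sqrtNeg1Sqrt15_inl_notMem_badPlaces_ratCast_of_mem_two hR v h2v (c := (ℓ : ℚ)) (by exact_mod_cast hℓ.pos)
    rwa [Rat.cast_natCast] at h
  rcases hv with h2v | hb
  · exact h2 h2v
  · exact absurd ((Ideal.eq_top_iff_one _).2 (by simpa using v.asIdeal.neg_mem hb)) v.isPrime.ne_top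

/-- **`ℚ(i,√15)` — THE UNION STATEMENT**: for `c ∈ ℚ_{>0}` and a finite place `v` of `F = ℚ(√15)` over the rational prime
`ℓ`: **`v ∈ T(c) ⟺ ord_ℓ(c)` is odd `∧ (ℓ % 60 = 7 ∨ ℓ % 60 = 11 ∨ ℓ % 60 = 43 ∨ ℓ % 60 = 59)`** — `T(c)` is the union of the full fibres of `Spec 𝓞_F → Spec ℤ`
over the non-norm primes of odd exponent in `c`. [cite: Deligne1982HodgeCycles, §4 (1) and Cor. 4.2]
[cite: Omeara1963, §63B Cor. 63:11a, Example 63:12 and §71D Thm. 71:18] -/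
theorem sqrtNeg1Sqrt15_inl_mem_badPlaces_ratCast_iff_odd_padicValRat (hR : R = X ^ 2 + C 32 * X + C 196) {c : ℚ} (hc : 0 < c)
    (v : HeightOneSpectrum (𝓞 (realField R))) {ℓ : ℕ} (hℓ : ℓ.Prime) (hℓv : (ℓ : 𝓞 (realField R)) ∈ v.asIdeal) :
    Sum.inl v ∈ badPlaces (c : realField R) (AdjoinRoot.root (realPolyQ R)) ↔
      Odd (padicValRat ℓ c) ∧ (ℓ % 60 = 7 ∨ ℓ % 60 = 11 ∨ ℓ % 60 = 43 ∨ ℓ % 60 = 59) := by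
  have hroots := roots_real_neg_of_quadratic hR (by norm_num) (by norm_num) (by norm_num)
  have hℓ0 : (ℓ : realField R) ≠ 0 := by exact_mod_cast hℓ.ne_zero
  have hT := badPlaces_nonempty_iff_mk_ne_splitDiscriminantClassCM (R := R) (Units.mk0 (ℓ : realField R) hℓ0) even_two
  rw [Units.val_mk0, sqrtNeg1Sqrt15_mk_prime_ne_splitDiscriminantClassCM_iff_mod hR hℓ _ (Units.val_mk0 _) even_two] at hT
  rw [inl_mem_badPlaces_ratCast_iff_odd_padicValRat hR hroots (sqrtNeg1Sqrt15_root_eq_sq_mul_neg_one hR)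
    (sqrtNeg1Sqrt15_inl_notMem_badPlaces_natCast_of_exceptional hR) hc v hℓ hℓv, hT]

/-- **`ℚ(i,√15)` — THE CLASSES OF THE POSITIVE RATIONALS**: for `c, c' ∈ ℚ_{>0}`, **`[c] = [c']` in
`F^×/Nm_{E/F}(E^×)` iff `ord_ℓ(c) ≡ ord_ℓ(c') (mod 2)` for every prime `ℓ` with `ℓ % 60 = 7 ∨ ℓ % 60 = 11 ∨ ℓ % 60 = 43 ∨ ℓ % 60 = 59`** — the positive rational
members of the table are classified by finite sets of non-norm primes. [cite: Deligne1982HodgeCycles, §4 (1), Prop. 4.1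
and Cor. 4.2] [cite: Omeara1963, §65D Thm. 65:23] -/
theorem sqrtNeg1Sqrt15_mk_ratCast_eq_mk_ratCast_iff (hR : R = X ^ 2 + C 32 * X + C 196) {c c' : ℚ} (hc : 0 < c) (hc' : 0 < c')
    (γ γ' : (realField R)ˣ) (hγ : (γ : realField R) = (c : realField R)) (hγ' : (γ' : realField R) = (c' : realField R)) :
    (QuotientGroup.mk γ : cmNormResidueGroup R) = QuotientGroup.mk γ' ↔
      ∀ ℓ : ℕ, ℓ.Prime → (ℓ % 60 = 7 ∨ ℓ % 60 = 11 ∨ ℓ % 60 = 43 ∨ ℓ % 60 = 59) → (Odd (padicValRat ℓ c) ↔ Odd (padicValRat ℓ c')) := by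
  have hroots := roots_real_neg_of_quadratic hR (by norm_num) (by norm_num) (by norm_num)
  rw [mk_ratCast_eq_mk_ratCast_iff hR hroots (sqrtNeg1Sqrt15_root_eq_sq_mul_neg_one hR) (sqrtNeg1Sqrt15_inl_notMem_badPlaces_natCast_of_exceptional hR)
    hc hc' γ γ' hγ hγ']
  refine forall_congr' fun ℓ ↦ forall_congr' fun hℓ ↦ ?_
  have hℓ0 : (ℓ : realField R) ≠ 0 := by exact_mod_cast hℓ.ne_zero
  have hT := badPlaces_nonempty_iff_mk_ne_splitDiscriminantClassCM (R := R) (Units.mk0 (ℓ : realField R) hℓ0) even_two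
  rw [Units.val_mk0, sqrtNeg1Sqrt15_mk_prime_ne_splitDiscriminantClassCM_iff_mod hR hℓ _ (Units.val_mk0 _) even_two] at hT
  rw [hT]

/-- **`ℚ(i,√15)` — THE SPLIT ROW**: for `c ∈ ℚ_{>0}`, **`[c] = [(-1)^k]` (`k` even: the split component, Deligne Cor. 4.2)
iff `ord_ℓ(c)` is EVEN for every prime `ℓ` with `ℓ % 60 = 7 ∨ ℓ % 60 = 11 ∨ ℓ % 60 = 43 ∨ ℓ % 60 = 59`.** [cite: Deligne1982HodgeCycles, §4 Cor. 4.2]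
[cite: Omeara1963, §65D Thm. 65:23] -/
theorem sqrtNeg1Sqrt15_mk_ratCast_eq_splitDiscriminantClassCM_iff (hR : R = X ^ 2 + C 32 * X + C 196) {c : ℚ} (hc : 0 < c)
    (γ : (realField R)ˣ) (hγ : (γ : realField R) = (c : realField R)) {k : ℕ} (hk : Even k) :
    (QuotientGroup.mk γ : cmNormResidueGroup R) = splitDiscriminantClassCM R k ↔
      ∀ ℓ : ℕ, ℓ.Prime → (ℓ % 60 = 7 ∨ ℓ % 60 = 11 ∨ ℓ % 60 = 43 ∨ ℓ % 60 = 59) → Even (padicValRat ℓ c) := by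
  have hroots := roots_real_neg_of_quadratic hR (by norm_num) (by norm_num) (by norm_num)
  rw [mk_ratCast_eq_splitDiscriminantClassCM_iff hR hroots (sqrtNeg1Sqrt15_root_eq_sq_mul_neg_one hR)
    (sqrtNeg1Sqrt15_inl_notMem_badPlaces_natCast_of_exceptional hR) hc γ hγ hk]
  refine forall_congr' fun ℓ ↦ forall_congr' fun hℓ ↦ ?_
  have hℓ0 : (ℓ : realField R) ≠ 0 := by exact_mod_cast hℓ.ne_zero
  have hT := badPlaces_nonempty_iff_mk_ne_splitDiscriminantClassCM (R := R) (Units.mk0 (ℓ : realField R) hℓ0) even_two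
  rw [Units.val_mk0, sqrtNeg1Sqrt15_mk_prime_ne_splitDiscriminantClassCM_iff_mod hR hℓ _ (Units.val_mk0 _) even_two] at hT
  rw [hT]

end IsqrtNeg1Sqrt15

/-! ### §126 `E = ℚ(√-5,√3)` (`R = S² + 40S + 100`, `F = ℚ(√3)`, `E = F(√-5)`; non-norm primes: `ℓ % 60 = 11 ∨ ℓ % 60 = 13 ∨ ℓ % 60 = 37 ∨ ℓ % 60 = 59`) -/
section IsqrtNeg5Sqrt3

/-- `ℚ(√-5,√3)`: **the dyadic place of `F = ℚ(√3)` and the places dividing the radicand `b₀ = -5` lie in no `T(ℓ)`**,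
`ℓ` a rational prime (parts 34–40). [cite: Omeara1963, §63B Example 63:12 and §71D Thm. 71:18]
[cite: Deligne1982HodgeCycles, §4 (1)] -/
theorem sqrtNeg5Sqrt3_inl_notMem_badPlaces_natCast_of_exceptional (hR : R = X ^ 2 + C 40 * X + C 100)
    (v : HeightOneSpectrum (𝓞 (realField R)))
    (hv : (2 : 𝓞 (realField R)) ∈ v.asIdeal ∨ (((-(5 : ℕ) : ℤ)) : 𝓞 (realField R)) ∈ v.asIdeal)
    (ℓ : ℕ) (hℓ : ℓ.Prime) :
    Sum.inl v ∉ badPlaces (ℓ : realField R) (AdjoinRoot.root (realPolyQ R)) := by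
  have h2 : (2 : 𝓞 (realField R)) ∈ v.asIdeal → Sum.inl v ∉ badPlaces (ℓ : realField R) (AdjoinRoot.root (realPolyQ R)) := by
    intro h2v
    have h := sqrtNeg5Sqrt3_inl_notMem_badPlaces_ratCast_of_mem_two hR v h2v (c := (ℓ : ℚ)) (by exact_mod_cast hℓ.pos)
    rwa [Rat.cast_natCast] at h
  rcases hv with h2v | hb
  · exact h2 h2v
  · have hb' : (5 : 𝓞 (realField R)) ∈ v.asIdeal := by simpa using v.asIdeal.neg_mem hb
    have h := sqrtNeg5Sqrt3_inl_notMem_badPlaces_ratCast_of_mem_five hR v hb' (c := (ℓ : ℚ)) (by exact_mod_cast hℓ.ne_zero)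
    rwa [Rat.cast_natCast] at h

/-- **`ℚ(√-5,√3)` — THE UNION STATEMENT**: for `c ∈ ℚ_{>0}` and a finite place `v` of `F = ℚ(√3)` over the rational prime
`ℓ`: **`v ∈ T(c) ⟺ ord_ℓ(c)` is odd `∧ (ℓ % 60 = 11 ∨ ℓ % 60 = 13 ∨ ℓ % 60 = 37 ∨ ℓ % 60 = 59)`** — `T(c)` is the union of the full fibres of `Spec 𝓞_F → Spec ℤ`
over the non-norm primes of odd exponent in `c`. [cite: Deligne1982HodgeCycles, §4 (1) and Cor. 4.2]
[cite: Omeara1963, §63B Cor. 63:11a, Example 63:12 and §71D Thm. 71:18] -/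
theorem sqrtNeg5Sqrt3_inl_mem_badPlaces_ratCast_iff_odd_padicValRat (hR : R = X ^ 2 + C 40 * X + C 100) {c : ℚ} (hc : 0 < c)
    (v : HeightOneSpectrum (𝓞 (realField R))) {ℓ : ℕ} (hℓ : ℓ.Prime) (hℓv : (ℓ : 𝓞 (realField R)) ∈ v.asIdeal) :
    Sum.inl v ∈ badPlaces (c : realField R) (AdjoinRoot.root (realPolyQ R)) ↔
      Odd (padicValRat ℓ c) ∧ (ℓ % 60 = 11 ∨ ℓ % 60 = 13 ∨ ℓ % 60 = 37 ∨ ℓ % 60 = 59) := by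
  have hroots := roots_real_neg_of_quadratic hR (by norm_num) (by norm_num) (by norm_num)
  have hℓ0 : (ℓ : realField R) ≠ 0 := by exact_mod_cast hℓ.ne_zero
  have hT := badPlaces_nonempty_iff_mk_ne_splitDiscriminantClassCM (R := R) (Units.mk0 (ℓ : realField R) hℓ0) even_two
  rw [Units.val_mk0, sqrtNeg5Sqrt3_mk_prime_ne_splitDiscriminantClassCM_iff_mod hR hℓ _ (Units.val_mk0 _) even_two] at hT
  rw [inl_mem_badPlaces_ratCast_iff_odd_padicValRat hR hroots (sqrtNeg5Sqrt3_root_eq_sq_mul_neg_five hR)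
    (sqrtNeg5Sqrt3_inl_notMem_badPlaces_natCast_of_exceptional hR) hc v hℓ hℓv, hT]

/-- **`ℚ(√-5,√3)` — THE CLASSES OF THE POSITIVE RATIONALS**: for `c, c' ∈ ℚ_{>0}`, **`[c] = [c']` in
`F^×/Nm_{E/F}(E^×)` iff `ord_ℓ(c) ≡ ord_ℓ(c') (mod 2)` for every prime `ℓ` with `ℓ % 60 = 11 ∨ ℓ % 60 = 13 ∨ ℓ % 60 = 37 ∨ ℓ % 60 = 59`** — the positive rational
members of the table are classified by finite sets of non-norm primes. [cite: Deligne1982HodgeCycles, §4 (1), Prop. 4.1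
and Cor. 4.2] [cite: Omeara1963, §65D Thm. 65:23] -/
theorem sqrtNeg5Sqrt3_mk_ratCast_eq_mk_ratCast_iff (hR : R = X ^ 2 + C 40 * X + C 100) {c c' : ℚ} (hc : 0 < c) (hc' : 0 < c')
    (γ γ' : (realField R)ˣ) (hγ : (γ : realField R) = (c : realField R)) (hγ' : (γ' : realField R) = (c' : realField R)) :
    (QuotientGroup.mk γ : cmNormResidueGroup R) = QuotientGroup.mk γ' ↔
      ∀ ℓ : ℕ, ℓ.Prime → (ℓ % 60 = 11 ∨ ℓ % 60 = 13 ∨ ℓ % 60 = 37 ∨ ℓ % 60 = 59) → (Odd (padicValRat ℓ c) ↔ Odd (padicValRat ℓ c')) := by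
  have hroots := roots_real_neg_of_quadratic hR (by norm_num) (by norm_num) (by norm_num)
  rw [mk_ratCast_eq_mk_ratCast_iff hR hroots (sqrtNeg5Sqrt3_root_eq_sq_mul_neg_five hR) (sqrtNeg5Sqrt3_inl_notMem_badPlaces_natCast_of_exceptional hR)
    hc hc' γ γ' hγ hγ']
  refine forall_congr' fun ℓ ↦ forall_congr' fun hℓ ↦ ?_
  have hℓ0 : (ℓ : realField R) ≠ 0 := by exact_mod_cast hℓ.ne_zero
  have hT := badPlaces_nonempty_iff_mk_ne_splitDiscriminantClassCM (R := R) (Units.mk0 (ℓ : realField R) hℓ0) even_two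
  rw [Units.val_mk0, sqrtNeg5Sqrt3_mk_prime_ne_splitDiscriminantClassCM_iff_mod hR hℓ _ (Units.val_mk0 _) even_two] at hT
  rw [hT]

/-- **`ℚ(√-5,√3)` — THE SPLIT ROW**: for `c ∈ ℚ_{>0}`, **`[c] = [(-1)^k]` (`k` even: the split component, Deligne Cor. 4.2)
iff `ord_ℓ(c)` is EVEN for every prime `ℓ` with `ℓ % 60 = 11 ∨ ℓ % 60 = 13 ∨ ℓ % 60 = 37 ∨ ℓ % 60 = 59`.** [cite: Deligne1982HodgeCycles, §4 Cor. 4.2]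
[cite: Omeara1963, §65D Thm. 65:23] -/
theorem sqrtNeg5Sqrt3_mk_ratCast_eq_splitDiscriminantClassCM_iff (hR : R = X ^ 2 + C 40 * X + C 100) {c : ℚ} (hc : 0 < c)
    (γ : (realField R)ˣ) (hγ : (γ : realField R) = (c : realField R)) {k : ℕ} (hk : Even k) :
    (QuotientGroup.mk γ : cmNormResidueGroup R) = splitDiscriminantClassCM R k ↔
      ∀ ℓ : ℕ, ℓ.Prime → (ℓ % 60 = 11 ∨ ℓ % 60 = 13 ∨ ℓ % 60 = 37 ∨ ℓ % 60 = 59) → Even (padicValRat ℓ c) := by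
  have hroots := roots_real_neg_of_quadratic hR (by norm_num) (by norm_num) (by norm_num)
  rw [mk_ratCast_eq_splitDiscriminantClassCM_iff hR hroots (sqrtNeg5Sqrt3_root_eq_sq_mul_neg_five hR)
    (sqrtNeg5Sqrt3_inl_notMem_badPlaces_natCast_of_exceptional hR) hc γ hγ hk]
  refine forall_congr' fun ℓ ↦ forall_congr' fun hℓ ↦ ?_
  have hℓ0 : (ℓ : realField R) ≠ 0 := by exact_mod_cast hℓ.ne_zero
  have hT := badPlaces_nonempty_iff_mk_ne_splitDiscriminantClassCM (R := R) (Units.mk0 (ℓ : realField R) hℓ0) even_two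
  rw [Units.val_mk0, sqrtNeg5Sqrt3_mk_prime_ne_splitDiscriminantClassCM_iff_mod hR hℓ _ (Units.val_mk0 _) even_two] at hT
  rw [hT]

end IsqrtNeg5Sqrt3

/-! ### §127 `E = ℚ(√-3,√-5)` (`R = S² + 16S + 4`, `F = ℚ(√15)`, `E = F(√-3)`; non-norm primes: `ℓ % 60 = 11 ∨ ℓ % 60 = 17 ∨ ℓ % 60 = 53 ∨ ℓ % 60 = 59`) -/
section IsqrtNeg3SqrtNeg5

/-- `ℚ(√-3,√-5)`: **the dyadic place of `F = ℚ(√15)` and the places dividing the radicand `b₀ = -3` lie in no `T(ℓ)`**,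
`ℓ` a rational prime (parts 34–40). [cite: Omeara1963, §63B Example 63:12 and §71D Thm. 71:18]
[cite: Deligne1982HodgeCycles, §4 (1)] -/
theorem sqrtNeg3SqrtNeg5_inl_notMem_badPlaces_natCast_of_exceptional (hR : R = X ^ 2 + C 16 * X + C 4)
    (v : HeightOneSpectrum (𝓞 (realField R)))
    (hv : (2 : 𝓞 (realField R)) ∈ v.asIdeal ∨ (((-(3 : ℕ) : ℤ)) : 𝓞 (realField R)) ∈ v.asIdeal)
    (ℓ : ℕ) (hℓ : ℓ.Prime) :
    Sum.inl v ∉ badPlaces (ℓ : realField R) (AdjoinRoot.root (realPolyQ R)) := by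
  have h2 : (2 : 𝓞 (realField R)) ∈ v.asIdeal → Sum.inl v ∉ badPlaces (ℓ : realField R) (AdjoinRoot.root (realPolyQ R)) := by
    intro h2v
    have h := sqrtNeg3SqrtNeg5_inl_notMem_badPlaces_ratCast_of_mem_two hR v h2v (c := (ℓ : ℚ)) (by exact_mod_cast hℓ.pos)
    rwa [Rat.cast_natCast] at h
  rcases hv with h2v | hb
  · exact h2 h2v
  · have hb' : (3 : 𝓞 (realField R)) ∈ v.asIdeal := by simpa using v.asIdeal.neg_mem hb
    have h := sqrtNeg3SqrtNeg5_inl_notMem_badPlaces_ratCast_of_mem_three hR v hb' (c := (ℓ : ℚ)) (by exact_mod_cast hℓ.ne_zero)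
    rwa [Rat.cast_natCast] at h

/-- **`ℚ(√-3,√-5)` — THE UNION STATEMENT**: for `c ∈ ℚ_{>0}` and a finite place `v` of `F = ℚ(√15)` over the rational prime
`ℓ`: **`v ∈ T(c) ⟺ ord_ℓ(c)` is odd `∧ (ℓ % 60 = 11 ∨ ℓ % 60 = 17 ∨ ℓ % 60 = 53 ∨ ℓ % 60 = 59)`** — `T(c)` is the union of the full fibres of `Spec 𝓞_F → Spec ℤ`
over the non-norm primes of odd exponent in `c`. [cite: Deligne1982HodgeCycles, §4 (1) and Cor. 4.2]
[cite: Omeara1963, §63B Cor. 63:11a, Example 63:12 and §71D Thm. 71:18] -/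
theorem sqrtNeg3SqrtNeg5_inl_mem_badPlaces_ratCast_iff_odd_padicValRat (hR : R = X ^ 2 + C 16 * X + C 4) {c : ℚ} (hc : 0 < c)
    (v : HeightOneSpectrum (𝓞 (realField R))) {ℓ : ℕ} (hℓ : ℓ.Prime) (hℓv : (ℓ : 𝓞 (realField R)) ∈ v.asIdeal) :
    Sum.inl v ∈ badPlaces (c : realField R) (AdjoinRoot.root (realPolyQ R)) ↔
      Odd (padicValRat ℓ c) ∧ (ℓ % 60 = 11 ∨ ℓ % 60 = 17 ∨ ℓ % 60 = 53 ∨ ℓ % 60 = 59) := by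
  have hroots := roots_real_neg_of_quadratic hR (by norm_num) (by norm_num) (by norm_num)
  have hℓ0 : (ℓ : realField R) ≠ 0 := by exact_mod_cast hℓ.ne_zero
  have hT := badPlaces_nonempty_iff_mk_ne_splitDiscriminantClassCM (R := R) (Units.mk0 (ℓ : realField R) hℓ0) even_two
  rw [Units.val_mk0, sqrtNeg3SqrtNeg5_mk_prime_ne_splitDiscriminantClassCM_iff_mod hR hℓ _ (Units.val_mk0 _) even_two] at hT
  rw [inl_mem_badPlaces_ratCast_iff_odd_padicValRat hR hroots (sqrtNeg3SqrtNeg5_root_eq_sq_mul_neg_three hR)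
    (sqrtNeg3SqrtNeg5_inl_notMem_badPlaces_natCast_of_exceptional hR) hc v hℓ hℓv, hT]

/-- **`ℚ(√-3,√-5)` — THE CLASSES OF THE POSITIVE RATIONALS**: for `c, c' ∈ ℚ_{>0}`, **`[c] = [c']` in
`F^×/Nm_{E/F}(E^×)` iff `ord_ℓ(c) ≡ ord_ℓ(c') (mod 2)` for every prime `ℓ` with `ℓ % 60 = 11 ∨ ℓ % 60 = 17 ∨ ℓ % 60 = 53 ∨ ℓ % 60 = 59`** — the positive rational
members of the table are classified by finite sets of non-norm primes. [cite: Deligne1982HodgeCycles, §4 (1), Prop. 4.1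
and Cor. 4.2] [cite: Omeara1963, §65D Thm. 65:23] -/
theorem sqrtNeg3SqrtNeg5_mk_ratCast_eq_mk_ratCast_iff (hR : R = X ^ 2 + C 16 * X + C 4) {c c' : ℚ} (hc : 0 < c) (hc' : 0 < c')
    (γ γ' : (realField R)ˣ) (hγ : (γ : realField R) = (c : realField R)) (hγ' : (γ' : realField R) = (c' : realField R)) :
    (QuotientGroup.mk γ : cmNormResidueGroup R) = QuotientGroup.mk γ' ↔
      ∀ ℓ : ℕ, ℓ.Prime → (ℓ % 60 = 11 ∨ ℓ % 60 = 17 ∨ ℓ % 60 = 53 ∨ ℓ % 60 = 59) → (Odd (padicValRat ℓ c) ↔ Odd (padicValRat ℓ c')) := by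
  have hroots := roots_real_neg_of_quadratic hR (by norm_num) (by norm_num) (by norm_num)
  rw [mk_ratCast_eq_mk_ratCast_iff hR hroots (sqrtNeg3SqrtNeg5_root_eq_sq_mul_neg_three hR) (sqrtNeg3SqrtNeg5_inl_notMem_badPlaces_natCast_of_exceptional hR)
    hc hc' γ γ' hγ hγ']
  refine forall_congr' fun ℓ ↦ forall_congr' fun hℓ ↦ ?_
  have hℓ0 : (ℓ : realField R) ≠ 0 := by exact_mod_cast hℓ.ne_zero
  have hT := badPlaces_nonempty_iff_mk_ne_splitDiscriminantClassCM (R := R) (Units.mk0 (ℓ : realField R) hℓ0) even_two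
  rw [Units.val_mk0, sqrtNeg3SqrtNeg5_mk_prime_ne_splitDiscriminantClassCM_iff_mod hR hℓ _ (Units.val_mk0 _) even_two] at hT
  rw [hT]

/-- **`ℚ(√-3,√-5)` — THE SPLIT ROW**: for `c ∈ ℚ_{>0}`, **`[c] = [(-1)^k]` (`k` even: the split component, Deligne Cor. 4.2)
iff `ord_ℓ(c)` is EVEN for every prime `ℓ` with `ℓ % 60 = 11 ∨ ℓ % 60 = 17 ∨ ℓ % 60 = 53 ∨ ℓ % 60 = 59`.** [cite: Deligne1982HodgeCycles, §4 Cor. 4.2]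
[cite: Omeara1963, §65D Thm. 65:23] -/
theorem sqrtNeg3SqrtNeg5_mk_ratCast_eq_splitDiscriminantClassCM_iff (hR : R = X ^ 2 + C 16 * X + C 4) {c : ℚ} (hc : 0 < c)
    (γ : (realField R)ˣ) (hγ : (γ : realField R) = (c : realField R)) {k : ℕ} (hk : Even k) :
    (QuotientGroup.mk γ : cmNormResidueGroup R) = splitDiscriminantClassCM R k ↔
      ∀ ℓ : ℕ, ℓ.Prime → (ℓ % 60 = 11 ∨ ℓ % 60 = 17 ∨ ℓ % 60 = 53 ∨ ℓ % 60 = 59) → Even (padicValRat ℓ c) := by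
  have hroots := roots_real_neg_of_quadratic hR (by norm_num) (by norm_num) (by norm_num)
  rw [mk_ratCast_eq_splitDiscriminantClassCM_iff hR hroots (sqrtNeg3SqrtNeg5_root_eq_sq_mul_neg_three hR)
    (sqrtNeg3SqrtNeg5_inl_notMem_badPlaces_natCast_of_exceptional hR) hc γ hγ hk]
  refine forall_congr' fun ℓ ↦ forall_congr' fun hℓ ↦ ?_
  have hℓ0 : (ℓ : realField R) ≠ 0 := by exact_mod_cast hℓ.ne_zero
  have hT := badPlaces_nonempty_iff_mk_ne_splitDiscriminantClassCM (R := R) (Units.mk0 (ℓ : realField R) hℓ0) even_two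
  rw [Units.val_mk0, sqrtNeg3SqrtNeg5_mk_prime_ne_splitDiscriminantClassCM_iff_mod hR hℓ _ (Units.val_mk0 _) even_two] at hT
  rw [hT]

end IsqrtNeg3SqrtNeg5

end Summit.HodgeConjecture.HodgeConjecture.Ring2.WeilCoverageCM

end
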